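import Summits.FinalStateConjecture.FinalStateConjecture.Theorems.SwallowTheDatumParametricKerrBurialEngine
import Summits.FinalStateConjecture.FinalStateConjecture.Theorems.SwallowTheDatumUniversalWitnessFamilyStubSchwOutSiteAux2
import Summits.FinalStateConjecture.FinalStateConjecture.Theorems.SwallowTheDatumUniversalWitnessFamilyStubPlugDataPlusFromOfAux2
import Literature.Geometry.Lorentzian.AveragedChargesScaling

/-!
# `ParametricKerrBurial`, line `receding-annulus-universal-collar` — stub `stub_siteMargin` (BK1), helper file 1:
# the exact time-symmetric Schwarzschild field at radius `32` and at radius `1` (crux item stmt-FinalStateConjecture-10052)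

The registered stub `stub_siteMargin` (file `SwallowTheDatumParametricKerrBurialStubSiteMargin.lean`) applies the hypothesis
block `MOTHyp` of Mao–Oh–Tao Thm 1.7 (engine file `SwallowTheDatumParametricKerrBurialEngine.lean`) with IN = the engine's exact
field `schwField mIn = (1 + mIn/(2‖y‖))⁴ • δ` read on `A_1` and OUT = a `C²`-small perturbation of `schwField mOut` read on `A_32`.
This file supplies the facts about the EXACT field (everything proved; no named facts):

* §1 `schwField` is the written-out field of the sibling crux's radius-`32` lemmas (`…UniversalWitnessFamilyStubSchwOutSiteAux1/2`),
  it is flat at mass `0`, covariant under dilations (`schwField (ρ m) (ρ x) = schwField m x`), and smooth off the origin;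
* §2 its η-averaged charges: at radius `32`, `12 m ≤ E ≤ 48 m` and `C = 0` (sibling crux); at radius `1` the SAME, by the
  scaling laws `avgE_dilate`, `avgC_dilate` of `Literature/Geometry/Lorentzian/AveragedChargesScaling.lean`
  (Mao–Oh–Tao §1.2, (1.2)): `E[schwField m; A_1] = 32⁻¹ E[schwField (32 m); A_32]`;
* §3 its `C²` deviation from `δ` on any annulus `{a ≤ ‖x‖ ≤ b}`, `a > 0`, is `≤ c·m` for `0 ≤ m ≤ 1` (binomial expansion
  `schw_sub_flat_eq` + compactness, verbatim the sibling crux's `exists_devBound` with the radii as parameters), whence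
  `DevLE (schwField m) 0 a b (c·m)`.

References: Mao–Oh–Tao arXiv:2308.13031 §1.2 (1.2)–(1.7), Rem 1.11; the crux directory's `PICKED.md`.
-/

set_option linter.dupNamespace false
-- the operator norm on `E3 [×m]→L[ℝ] (E3 →L[ℝ] E3 →L[ℝ] ℝ)` needs a longer instance search than the default budget
set_option synthInstance.maxHeartbeats 120000

noncomputable section

-- instance search through the nested operator types `E3 →L E3 →L ℝ`
set_option maxSynthPendingDepth 3

namespace Summit.FinalStateConjecture.FinalStateConjecture.Theorems.SwallowTheDatum.ParametricKerrBurial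

open scoped Manifold ContDiff Topology BigOperators InnerProductSpace
open Bundle Set Filter Function MeasureTheory Literature.Geometry.Lorentzian
open Literature.Geometry.Lorentzian.MaoOhTao Literature.Geometry.Lorentzian.InitialDataSet
open Summit.FinalStateConjecture.FinalStateConjecture.Theorems.SwallowTheDatum.UniversalWitnessFamily

/-! ## §1 The Schwarzschild field: germ form, dilation covariance, smoothness off the origin -/

/-- The engine's `schwField m` IS the written-out field `(1 + m/(2‖y‖))⁴ • δ` off `B_{1/4}` (indeed everywhere);
this is the agreement hypothesis of the radius-`32` lemmas of the sibling crux. [folklore] -/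
theorem sm_schwField_agree (m : ℝ) : ∀ y : E3, 1 / 4 < ‖y‖ →
    schwField m y = (1 + m / (2 * ‖y‖)) ^ 4 • (innerSL ℝ : E3 →L[ℝ] E3 →L[ℝ] ℝ) := fun _ _ ↦ rfl

/-- Schwarzschild of mass `0` is the flat field. [folklore] -/
theorem sm_schwField_zero : schwField 0 = flatField := by
  funext y
  simp [schwField, flatField]

/-- **Dilation covariance**: `schwField (ρ m) (ρ x) = schwField m x` for `ρ > 0`. [folklore] -/
theorem sm_schwField_dilate {ρ : ℝ} (hρ : 0 < ρ) (m : ℝ) :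
    (fun x : E3 ↦ schwField (ρ * m) (ρ • x)) = schwField m := by
  funext x
  have h : ρ * m / (2 * (ρ * ‖x‖)) = m / (2 * ‖x‖) := by
    rw [mul_left_comm, mul_div_mul_left _ _ hρ.ne']
  simp only [schwField, norm_smul, Real.norm_eq_abs, abs_of_pos hρ, h]

/-- The Schwarzschild field is smooth away from the origin. [folklore] -/
theorem sm_contDiffAt_schwField (m : ℝ) {x : E3} (hx : x ≠ 0) {n : WithTop ℕ∞} :
    ContDiffAt ℝ n (schwField m) x := by
  have h1 : ContDiffAt ℝ n (fun y : E3 ↦ ‖y‖) x := contDiffAt_norm ℝ hx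
  have h2 : ContDiffAt ℝ n (fun y : E3 ↦ (1 + m / (2 * ‖y‖)) ^ 4) x :=
    (contDiffAt_const.add (contDiffAt_const.div (contDiffAt_const.mul h1)
      (mul_ne_zero two_ne_zero (norm_ne_zero_iff.2 hx)))).pow 4
  exact h2.smul contDiffAt_const

/-- The Schwarzschild field is smooth on every exterior region `{a < ‖x‖}`, `a ≥ 0`. [folklore] -/
theorem sm_contDiffOn_schwField (m : ℝ) {a : ℝ} (ha : 0 ≤ a) {n : WithTop ℕ∞} :
    ContDiffOn ℝ n (schwField m) {x : E3 | a < ‖x‖} := fun _ hx ↦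
  (sm_contDiffAt_schwField m (norm_pos_iff.1 (ha.trans_lt hx)) (n := n)).contDiffWithinAt

/-! ## §2 The charges of the exact Schwarzschild field at radius `32` and at radius `1` -/

section Charges

variable {η : ℝ → ℝ}

/-- **`E` at radius `32`**: `12 m ≤ E[schwField m; A_32] ≤ 48 m` for `0 < m ≤ 1`, `m ∫|η| ≤ 8` (sibling crux,
`avgE32_bounds`). [cite: MaoOhTao2023, §1.2 (1.3), (1.7)] -/
theorem sm_avgE32_schwField_bounds (hη : IsBump η) {m : ℝ} (hm : 0 < m) (hm1 : m ≤ 1)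
    (hmK : m * ∫ s, |η s| ≤ 8) :
    12 * m ≤ avgE η 32 (schwField m) ∧ avgE η 32 (schwField m) ≤ 48 * m :=
  avgE32_bounds hη (sm_schwField_agree m) hm hm1 hmK

/-- **`C` at radius `32` vanishes** for the exact Schwarzschild field (oddness; sibling crux, `avgC32_eq_zero`).
[cite: MaoOhTao2023, §1.2 (1.5), (1.7)] -/
theorem sm_avgC32_schwField (hη : IsBump η) (m : ℝ) (l : Fin 3) : avgC η 32 (schwField m) l = 0 :=
  avgC32_eq_zero hη (sm_schwField_agree m) l

/-- **`E` at radius `1` by dilation**: `E[schwField m; A_1] = 32⁻¹ E[schwField (32 m); A_32]` (the scaling law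
`avgE_dilate` of Mao–Oh–Tao §1.2 and the dilation covariance of the field). [cite: MaoOhTao2023, §1.2 (1.2)] -/
theorem sm_avgE_one_schwField (η : ℝ → ℝ) (m : ℝ) :
    avgE η 1 (schwField m) = 32⁻¹ * avgE η 32 (schwField (32 * m)) := by
  have h := avgE_dilate η 1 (by norm_num : (0 : ℝ) < 32) (schwField (32 * m))
  rwa [sm_schwField_dilate (by norm_num : (0 : ℝ) < 32) m, mul_one] at h

/-- **`C` at radius `1` vanishes** for the exact Schwarzschild field (dilation of the radius-`32` statement).
[cite: MaoOhTao2023, §1.2 (1.2), (1.5)] -/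
theorem sm_avgC_one_schwField (hη : IsBump η) (m : ℝ) (l : Fin 3) : avgC η 1 (schwField m) l = 0 := by
  have h := avgC_dilate η 1 (by norm_num : (0 : ℝ) < 32) (schwField (32 * m)) l
  rw [sm_schwField_dilate (by norm_num : (0 : ℝ) < 32) m, mul_one, sm_avgC32_schwField hη, mul_zero] at h
  exact h

/-- **`E` at radius `1`**: `12 m ≤ E[schwField m; A_1] ≤ 48 m` for `0 ≤ m`, `32 m ≤ 1`, `32 m ∫|η| ≤ 8`.
[cite: MaoOhTao2023, §1.2 (1.3), (1.7)] -/
theorem sm_avgE_one_schwField_bounds (hη : IsBump η) {m : ℝ} (hm : 0 ≤ m) (hm1 : 32 * m ≤ 1)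
    (hmK : 32 * m * ∫ s, |η s| ≤ 8) :
    12 * m ≤ avgE η 1 (schwField m) ∧ avgE η 1 (schwField m) ≤ 48 * m := by
  rcases hm.eq_or_lt with h0 | hpos
  · rw [← h0, sm_schwField_zero, show avgE η 1 flatField = 0 from PlugDataPlus.avgE_flat η 1]
    norm_num
  · have h := sm_avgE32_schwField_bounds hη (by positivity : 0 < 32 * m) hm1 hmK
    rw [sm_avgE_one_schwField]
    constructor <;> linarith [h.1, h.2]

end Charges

/-! ## §3 The `C²` deviation of the Schwarzschild field on an annulus `{a ≤ ‖x‖ ≤ b}`, `a > 0` -/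

/-- Each `D^j F_k`, `F_k(y) = (2‖y‖)^{-k} • δ`, is bounded on the compact annulus `{a ≤ ‖x‖ ≤ b}`, `a > 0`
(continuity of the iterated derivative of a function smooth on the open set `{a/2 < ‖y‖}`). [folklore] -/
theorem sm_exists_bound_Fk (k j : ℕ) {a : ℝ} (ha : 0 < a) (b : ℝ) :
    ∃ B : ℝ, 0 ≤ B ∧ ∀ x : E3, a ≤ ‖x‖ → ‖x‖ ≤ b →
      ‖iteratedFDeriv ℝ j (fun y : E3 ↦ ((2 * ‖y‖)⁻¹) ^ k • (innerSL ℝ : E3 →L[ℝ] E3 →L[ℝ] ℝ)) x‖ ≤ B := by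
  set F : E3 → E3 →L[ℝ] E3 →L[ℝ] ℝ := fun y : E3 ↦ ((2 * ‖y‖)⁻¹) ^ k • innerSL ℝ with hF_def
  set U : Set E3 := {y | a / 2 < ‖y‖} with hU_def
  have hU : IsOpen U := isOpen_lt continuous_const continuous_norm
  have hcd : ContDiffOn ℝ (j : ℕ∞) F U := fun y hy ↦
    (contDiffAt_Fk k (norm_pos_iff.1 (lt_trans (half_pos ha) hy))).contDiffWithinAt
  have hc1 : ContinuousOn (iteratedFDerivWithin ℝ j F U) U :=
    hcd.continuousOn_iteratedFDerivWithin le_rfl hU.uniqueDiffOn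
  have hc2 : ContinuousOn (iteratedFDeriv ℝ j F) U :=
    hc1.congr fun y hy ↦ (iteratedFDerivWithin_of_isOpen j hU hy).symm
  set A : Set E3 := {y | a ≤ ‖y‖} ∩ {y | ‖y‖ ≤ b} with hA_def
  have hAc : IsClosed A :=
    (isClosed_le continuous_const continuous_norm).inter (isClosed_le continuous_norm continuous_const)
  have hA : IsCompact A :=
    (isCompact_closedBall (0 : E3) b).of_isClosed_subset hAc fun y hy ↦ mem_closedBall_zero_iff.2 hy.2
  have hAU : A ⊆ U := fun y hy ↦ show a / 2 < ‖y‖ from lt_of_lt_of_le (half_lt_self ha) hy.1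
  obtain ⟨C, hC⟩ := hA.exists_bound_of_continuousOn (hc2.mono hAU)
  exact ⟨max C 0, le_max_right _ _, fun x h1 h2 ↦ (hC x ⟨h1, h2⟩).trans (le_max_left _ _)⟩

/-- **`C²` deviation of the Schwarzschild field is `O(m)` on `{a ≤ ‖x‖ ≤ b}`, `a > 0`**: there is `c > 0` with
`‖D^j(schwField m − δ)(x)‖ ≤ c·m` for `j ≤ 2`, `a ≤ ‖x‖ ≤ b`, `0 ≤ m ≤ 1` (binomial expansion
`schw_sub_flat_eq` and compactness, as in the sibling crux's `exists_devBound`). [folklore] -/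
theorem sm_exists_devBound {a : ℝ} (ha : 0 < a) (b : ℝ) :
    ∃ c : ℝ, 0 < c ∧ ∀ m : ℝ, 0 ≤ m → m ≤ 1 → ∀ j : ℕ, j ≤ 2 → ∀ x : E3, a ≤ ‖x‖ → ‖x‖ ≤ b →
      ‖iteratedFDeriv ℝ j (fun y : E3 ↦ schwField m y - (innerSL ℝ : E3 →L[ℝ] E3 →L[ℝ] ℝ)) x‖ ≤ c * m := by
  have hb : ∀ k : ℕ, ∃ B : ℝ, 0 ≤ B ∧ ∀ j : ℕ, j ≤ 2 → ∀ x : E3, a ≤ ‖x‖ → ‖x‖ ≤ b →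
      ‖iteratedFDeriv ℝ j (fun y : E3 ↦ ((2 * ‖y‖)⁻¹) ^ k • (innerSL ℝ : E3 →L[ℝ] E3 →L[ℝ] ℝ)) x‖ ≤ B := by
    intro k
    obtain ⟨B0, h0, hB0⟩ := sm_exists_bound_Fk k 0 ha b
    obtain ⟨B1, h1, hB1⟩ := sm_exists_bound_Fk k 1 ha b
    obtain ⟨B2, h2, hB2⟩ := sm_exists_bound_Fk k 2 ha b
    refine ⟨B0 + B1 + B2, by positivity, fun j hj x hx1 hx2 ↦ ?_⟩
    interval_cases j
    · linarith [hB0 x hx1 hx2]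
    · linarith [hB1 x hx1 hx2]
    · linarith [hB2 x hx1 hx2]
  obtain ⟨B1, hB1, h1⟩ := hb 1
  obtain ⟨B2, hB2, h2⟩ := hb 2
  obtain ⟨B3, hB3, h3⟩ := hb 3
  obtain ⟨B4, hB4, h4⟩ := hb 4
  refine ⟨4 * B1 + 6 * B2 + 4 * B3 + B4 + 1, by positivity, ?_⟩
  intro m hm0 hm1 j hj x hx1 hx2
  have hx : x ≠ 0 := norm_pos_iff.1 (lt_of_lt_of_le ha hx1)
  -- scalar bookkeeping first (so that `nlinarith` never sees the operator norms)
  have hp2 : m ^ 2 ≤ m := by nlinarith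
  have hp3 : m ^ 3 ≤ m := by nlinarith
  have hp4 : m ^ 4 ≤ m := by nlinarith
  have hm2 : 6 * m ^ 2 * B2 ≤ 6 * m * B2 := by
    have := mul_le_mul_of_nonneg_right hp2 hB2
    linarith
  have hm3 : 4 * m ^ 3 * B3 ≤ 4 * m * B3 := by
    have := mul_le_mul_of_nonneg_right hp3 hB3
    linarith
  have hm4 : m ^ 4 * B4 ≤ m * B4 := mul_le_mul_of_nonneg_right hp4 hB4
  have hfin : 4 * m * B1 + 6 * m * B2 + 4 * m * B3 + m * B4 ≤ (4 * B1 + 6 * B2 + 4 * B3 + B4 + 1) * m := by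
    nlinarith
  have hA : ∀ k : ℕ,
      ContDiffAt ℝ (j : ℕ∞) (fun y : E3 ↦ ((2 * ‖y‖)⁻¹) ^ k • (innerSL ℝ : E3 →L[ℝ] E3 →L[ℝ] ℝ)) x :=
    fun k ↦ contDiffAt_Fk k hx
  have key := norm_iteratedFDeriv_comb4_le (hA 1) (hA 2) (hA 3) (hA 4) (4 * m) (6 * m ^ 2) (4 * m ^ 3) (m ^ 4)
  rw [abs_of_nonneg (by positivity : 0 ≤ 4 * m), abs_of_nonneg (by positivity : 0 ≤ 6 * m ^ 2),
    abs_of_nonneg (by positivity : 0 ≤ 4 * m ^ 3), abs_of_nonneg (by positivity : 0 ≤ m ^ 4)] at key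
  rw [show (fun y : E3 ↦ schwField m y - (innerSL ℝ : E3 →L[ℝ] E3 →L[ℝ] ℝ)) =
      (fun y : E3 ↦ (1 + m / (2 * ‖y‖)) ^ 4 • (innerSL ℝ : E3 →L[ℝ] E3 →L[ℝ] ℝ) - innerSL ℝ) from rfl,
    schw_sub_flat_eq]
  refine key.trans (le_trans ?_ hfin)
  have t1 := mul_le_mul_of_nonneg_left (h1 j hj x hx1 hx2) (by positivity : 0 ≤ 4 * m)
  have t2 := (mul_le_mul_of_nonneg_left (h2 j hj x hx1 hx2) (by positivity : 0 ≤ 6 * m ^ 2)).trans hm2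
  have t3 := (mul_le_mul_of_nonneg_left (h3 j hj x hx1 hx2) (by positivity : 0 ≤ 4 * m ^ 3)).trans hm3
  have t4 := (mul_le_mul_of_nonneg_left (h4 j hj x hx1 hx2) (by positivity : 0 ≤ m ^ 4)).trans hm4
  exact add_le_add (add_le_add (add_le_add t1 t2) t3) t4

/-- **`DevLE` of the exact time-symmetric Schwarzschild field**: with a constant `c` as in `sm_exists_devBound`,
`DevLE (schwField m) 0 a b (c·m)` for `0 ≤ m ≤ 1`. [folklore] -/
theorem sm_devLE_schwField {c a b m : ℝ}
    (hc : ∀ m : ℝ, 0 ≤ m → m ≤ 1 → ∀ j : ℕ, j ≤ 2 → ∀ x : E3, a ≤ ‖x‖ → ‖x‖ ≤ b →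
      ‖iteratedFDeriv ℝ j (fun y : E3 ↦ schwField m y - (innerSL ℝ : E3 →L[ℝ] E3 →L[ℝ] ℝ)) x‖ ≤ c * m)
    (hm0 : 0 ≤ m) (hm1 : m ≤ 1) : DevLE (schwField m) zeroField a b (c * m) := by
  intro x hx1 hx2
  have hcm : 0 ≤ c * m := (norm_nonneg _).trans (hc m hm0 hm1 0 (by norm_num) x hx1 hx2)
  refine ⟨fun j hj ↦ hc m hm0 hm1 j hj x hx1 hx2, fun j _ ↦ ?_⟩
  show ‖iteratedFDeriv ℝ j (fun _ : E3 ↦ (0 : E3 →L[ℝ] E3 →L[ℝ] ℝ)) x‖ ≤ c * m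
  rw [iteratedFDeriv_fun_zero]
  simpa using hcm


/-! ## Anchor -/

/-- **Anchor of this helper file** (registered sub-goal `stub_siteMarginAux1_anchor` of item 10052): the averaged centre of
mass on `A_1` of the exact Schwarzschild field vanishes (`sm_avgC_one_schwField`). [cite: MaoOhTao2023, §1.2 (1.2), (1.5)] -/
theorem stub_siteMarginAux1_anchor : ∀ (η : ℝ → ℝ) (m : ℝ) (l : Fin 3), IsBump η → avgC η 1 (schwField m) l = 0 :=
  fun _ m l hη ↦ sm_avgC_one_schwField hη m l

end Summit.FinalStateConjecture.FinalStateConjecture.Theorems.SwallowTheDatum.ParametricKerrBurial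

end
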